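import Summits.QuantumFields.BalabanUV.T4Continuum.Spine.NE3.PairLandauDivB8
import Summits.QuantumFields.BalabanUV.T4Continuum.Spine.NE3.AvgKernelQprimeB8
import Summits.QuantumFields.BalabanUV.T4Continuum.Spine.NE3.PairLeftChartB8
import Literature.MathematicalPhysics.QuantumFieldTheory.Balaban1983to89.B8Eq138LandauZd
import HarnessLib

/-!
# T⁴ programme, node NE3 (pub-ymgap DAG node N16) — THE (1.38) DICTIONARY CLOSED ON THE TORUS: node N05's concrete Landau condition
# `B8Eq138LandauZd.IsLandau138 L k η univ (torusLam k) W A` (multiplier form «Δ_W(D*_W A) = Q′_k(W)ᵀμ», seat n05-a) IMPLIES THE END's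
# `IsLandauB8 L N k W (Ad_{W⁻¹}(iηA))` — by Δ-symmetry, the `k`-step transpose identity for `Q′_k` on period boxes, and `N(Q′(W)) = ker Q′_k(W)`
# (`PairLandau138B8`)

Cell `pub-ymgap`, HUMAN RULING D-0062, seat `pub-ymgap-dag-n16-b` (FIRST-MISSING-ESTIMATE for N16 = NE3; writer prover-pub-ymgap-dag-n16-b-g2-0,
2026-08-26).  Companion of `Spine/NE3/PairLandauDivB8` ((1.38) in divergence form), `Spine/NE3/AvgKernelQprimeB8` (`N(Q′(W)) = ker Q′_k`) and of
node N05's `Literature/…/B8Eq138LandauZd` (the concrete (1.38) on the ℤᵈ carriers, multiplier form, 2026-08-26).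

WHY.  The census [N16B-CENSUS] left ONE member of THE END's `LandauRepB8Avg` without a dictionary: `landau` = `IsLandauB8 L N k W Z` — waiting
for node N05's concrete (1.38).  That object now exists: `IsLandau138 L m η Ω₀ Λs U₀ A := ∃ μ, ∀ x ∈ Ω₀, Δ^η_{U₀}↾Ω₀(D^{η*}_{U₀}A)(x) =
(Q′(U₀)ᵀμ)(x)` (`covLap`, `covDivB`, `QT`), whose transpose stencil is CERTIFIED against every `Ad`-invariant pairing (`sum_pairing_Qprime_eq`).
In THE END's geometry (reading (R-a): `Ω₀ = T_η` ↦ `Set.univ`, `Λ_j = B8Thm4TorusAt.torusLam k j`, `m = k`, everything `(N·Lᵏ)`-periodic)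
the multiplier form IMPLIES the variational form: pair `Δ_W(D*_W A) = Q′_kᵀμ_k` against a test field `ν ∈ N(Q′(W))` over the period box —
`⟨D*A, Δν⟩ = ⟨Δ D*A, ν⟩ = ⟨Q′_kᵀμ_k, ν⟩ = ⟨μ_k, Q′_kν⟩ = 0`.  This is the direction THE END consumes (N05 PROVIDES `IsLandau138`, N16 USES
`IsLandauB8`); the converse (variational ⇒ multiplier: `(ker Q′)^⊥ = range Q′ᵀ` in the finite-dimensional `hsR`-space) is not needed and not
proved.

WHAT ([folklore]; 0 def, 0 sorry):
* §1 letters: `covDeriv η W μ F = η⁻¹•cDstar W μ F`, `covDerivFwd η W μ f = η⁻¹•cD W μ f` (definitional up to `conjR = Ad`); hence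
  `cdiv W A = −η•covDivB η W A`, `covLapSite W f = η²•covLap η W f`; complex homogeneity of `cdiv`, `covLapSite`, `qprimeT1`∕`QprimeT` (real homogeneity of `covLapSite` is `NestedMeanSmoothInterpolant.covLapSite_smul_fun`);
  `bgT = transp` (the transporters of (1.29) ARE those of `Q′_k`, definitional); `hsR X (r•Y) = r·hsR X Y`.
* §2 **Δ-symmetry on the torus** (`sum_hsR_covLapSite_comm`): `Σ_x hsR (F x) (Δ_W ν x) = Σ_x hsR (Δ_W F x) (ν x)` for periodic unitary `W`,
  periodic `F, ν` (twice `NE3CovariantCalculus.sum_hsR_cD`).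
* §3 **the transpose on period boxes**: the blocks of `periodBox P` tile `periodBox (L·P)` (`biUnion_blockSites_periodBox`); ONE STEP
  (`sum_hsR_qprime_step`): `Σ_{y∈periodBox P} hsR (ν y) ((Q′λ)(y)) = Σ_{x∈periodBox (L·P)} hsR ((Q′ᵀν)(x)) (λ x)` for UNITARY transporters
  (`hsR`'s `Ad`-invariance holds for unitaries only — n05-a's `sum_pairing_Qprime_eq` asks it for all units, so the step is re-proved here);
  `k` STEPS (`sum_hsR_QprimeIter_eq`): `Σ_{y∈periodBox P} hsR (ν y) (Q′_jλ (y)) = Σ_{x∈periodBox (Lʲ·P)} hsR (Q′_jᵀν (x)) (λ x)`.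
* §4 **`isLandauB8_of_isLandau138_torus`**: for `L ≥ 1`, `N ≥ 1`, `η ≠ 0`, `W` unitary `(N·Lᵏ)`-periodic with unitary averaged backgrounds
  `avgIter L W j` (`j < k`), `A` periodic: `IsLandau138 L k η Set.univ (torusLam k) W A → IsLandauB8 L N k W (fun x μ ↦ Ad (W x μ)⁻¹ (iEta η A x μ))`.
HONEST FRAMING (page 1): a dictionary (one direction); `IsLandau138` for Bałaban's minimisers is [B8] Thm 4 in the all-torus geometry
(N05's, NOT proved; the typed `Thm4At` is cube-local — census [INTERFACE-GAP-1]); Thm 2 ∕ NE3 NOT proved; spine 0∕9; finite T⁴ rung (B)+1 at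
fixed ε — NOT infinite volume, NOT mass gap, NOT `BetaPertH`, NOT Clay.  PLACEMENT: `Spine/NE3/`.
-/

set_option autoImplicit false

open scoped BigOperators Matrix Matrix.Norms.L2Operator
open NormedSpace

namespace Summit.QuantumFields.BalabanUV.T4Continuum.NE3.PairLandau138B8

open Literature.MathematicalPhysics.QuantumFieldTheory.Balaban1983to89
open B7Prop1Explicit B7Prop2Explicit
open B7Eq78Linearization (conjR Qprime QprimeIter QprimeIter_succ zdBlocking)
open B7Eq214GeneralQprime (transp)
open B8Ineq132 (covDeriv covDerivFwd)
open B8Eq119TwistedAxial (bgT)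
open B8Eq146AExpansion (iEta)
open B8Eq138LandauZd (covDivB covLap qprimeT1 QprimeT QT IsLandau138 QprimeT_zero)
open Literature.MathematicalPhysics.QuantumLattice (blockMap blockSites mem_blockSites_iff)
open T4AveragingDeficitWall (IsUnitaryCfg Ad)
open T4AveragingDeficitWallBoundary (periodBox mem_periodBox IsPeriodicCfg)
open AveragingDeficitPeriodicCounting (IsPeriodicDir)
open AveragingDeficitNearIdentity (Ad_smul Ad_real_smul)
open NE3CovariantCalculus (hsR hsR_Ad_left hsR_sub_left hsR_sub_right hsR_sum_left hsR_sum_right cD cDstar cdiv cD_periodic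
  cDstar_periodic sum_hsR_cD)
open NE3.PairLandauB8 (avgKernelGauges covLapSite IsLandauB8)
open NE3.PairLandauDivB8 (isLandauB8_AdInv_iff_cdiv covLapSite_periodic)
open NE3.AvgKernelQprimeB8 (mem_avgKernelGauges_iff)
open MinimalActionClassSix (conjR_eq_Ad)

noncomputable section

variable {d : ℕ} {n : Type*} [Fintype n] [DecidableEq n]

/-! ## §1 Letters -/

/-- `(1.1)₂ = η⁻¹ · cDstar`: `covDeriv η W μ F x = η⁻¹ • cDstar W μ F x`. [folklore] -/
theorem covDeriv_eq_smul_cDstar (η : ℝ) (W : Site d → Fin d → (Matrix n n ℂ)ˣ) (μ : Fin d) (F : Site d → Matrix n n ℂ) (x : Site d) :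
    covDeriv η W μ F x = η⁻¹ • cDstar W μ F x := rfl

/-- `(1.1)₁ = η⁻¹ · cD`: `covDerivFwd η W μ f x = η⁻¹ • cD W μ f x`. [folklore] -/
theorem covDerivFwd_eq_smul_cD (η : ℝ) (W : Site d → Fin d → (Matrix n n ℂ)ˣ) (μ : Fin d) (f : Site d → Matrix n n ℂ) (x : Site d) :
    covDerivFwd η W μ f x = η⁻¹ • cD W μ f x := rfl

/-- **`D^{η*}_W A = −η⁻¹ · cdiv W A`** (the start-frame divergences of the two lineages). [folklore] -/
theorem covDivB_eq (η : ℝ) (W : Site d → Fin d → (Matrix n n ℂ)ˣ) (A : Site d → Fin d → Matrix n n ℂ) (x : Site d) :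
    covDivB η W A x = -(η⁻¹ • cdiv W A x) := by
  unfold covDivB cdiv
  rw [Finset.smul_sum, ← Finset.sum_neg_distrib]
  refine Finset.sum_congr rfl fun μ _ => ?_
  rw [covDeriv_eq_smul_cDstar, ← smul_neg, neg_sub]
  rfl

/-- `cD W μ (r • f) = r • cD W μ f` (real `r`). [folklore] -/
theorem cD_real_smul (W : Site d → Fin d → (Matrix n n ℂ)ˣ) (μ : Fin d) (r : ℝ) (f : Site d → Matrix n n ℂ) (x : Site d) :
    cD W μ (fun z => r • f z) x = r • cD W μ f x := by
  unfold cD; rw [Ad_real_smul, smul_sub]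

/-- `cDstar W μ (r • g) = r • cDstar W μ g` (real `r`). [folklore] -/
theorem cDstar_real_smul (W : Site d → Fin d → (Matrix n n ℂ)ˣ) (μ : Fin d) (r : ℝ) (g : Site d → Matrix n n ℂ) (x : Site d) :
    cDstar W μ (fun z => r • g z) x = r • cDstar W μ g x := by
  unfold cDstar; rw [Ad_real_smul, smul_sub]

/-- **`Δ^η_W f = η⁻² · covLapSite W f`**: `covLap η W f x = η⁻¹ • (η⁻¹ • covLapSite W f x)`. [folklore] -/
theorem covLap_eq (η : ℝ) (W : Site d → Fin d → (Matrix n n ℂ)ˣ) (f : Site d → Matrix n n ℂ) (x : Site d) :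
    covLap η W f x = η⁻¹ • (η⁻¹ • covLapSite W f x) := by
  unfold covLap covDivB covLapSite
  rw [Finset.smul_sum, Finset.smul_sum]
  refine Finset.sum_congr rfl fun μ _ => ?_
  rw [covDeriv_eq_smul_cDstar]
  congr 1
  have h : (fun z => covDerivFwd η W μ f z) = fun z => η⁻¹ • cD W μ f z := by
    funext z; exact covDerivFwd_eq_smul_cD η W μ f z
  rw [h, cDstar_real_smul]

/-- `cdiv W (c • A) = c • cdiv W A` (complex `c`). [folklore] -/
theorem cdiv_smulC (W : Site d → Fin d → (Matrix n n ℂ)ˣ) (c : ℂ) (A : Site d → Fin d → Matrix n n ℂ) (x : Site d) :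
    cdiv W (fun z μ => c • A z μ) x = c • cdiv W A x := by
  unfold cdiv
  rw [Finset.smul_sum]
  exact Finset.sum_congr rfl fun μ _ => by rw [Ad_smul, smul_sub]

/-- `covLapSite W (c • f) = c • covLapSite W f` (complex `c`). [folklore] -/
theorem covLapSite_smulC (W : Site d → Fin d → (Matrix n n ℂ)ˣ) (c : ℂ) (f : Site d → Matrix n n ℂ) (x : Site d) :
    covLapSite W (fun z => c • f z) x = c • covLapSite W f x := by
  unfold covLapSite
  rw [Finset.smul_sum]
  refine Finset.sum_congr rfl fun ν _ => ?_
  have h : cD W ν (fun z => c • f z) = fun z => c • cD W ν f z := by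
    funext z; unfold cD; rw [Ad_smul, smul_sub]
  rw [h]
  unfold cDstar
  rw [Ad_smul, smul_sub]

/-- `qprimeT1` is complex homogeneous. [folklore] -/
theorem qprimeT1_smulC (L : ℕ) (W : Site d → Fin d → (Matrix n n ℂ)ˣ) (j : ℕ) (c : ℂ) (ν : Site d → Matrix n n ℂ) (x : Site d) :
    qprimeT1 L W j (fun y => c • ν y) x = c • qprimeT1 L W j ν x := by
  unfold qprimeT1
  rw [conjR_eq_Ad, conjR_eq_Ad, Ad_smul, smul_comm]

/-- `Q′_jᵀ` is complex homogeneous. [folklore] -/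
theorem QprimeT_smulC (L : ℕ) (W : Site d → Fin d → (Matrix n n ℂ)ˣ) (c : ℂ) :
    ∀ (j : ℕ) (ν : Site d → Matrix n n ℂ) (x : Site d), QprimeT L W j (fun y => c • ν y) x = c • QprimeT L W j ν x
  | 0, ν, x => rfl
  | j + 1, ν, x => by
    show QprimeT L W j (qprimeT1 L W j (fun y => c • ν y)) x = c • QprimeT L W j (qprimeT1 L W j ν) x
    have h : qprimeT1 L W j (fun y => c • ν y) = fun y => c • qprimeT1 L W j ν y := by
      funext y; exact qprimeT1_smulC L W j c ν y
    rw [h, QprimeT_smulC L W c j]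

/-- `Q′_jᵀ` is real homogeneous. [folklore] -/
theorem QprimeT_real_smul (L : ℕ) (W : Site d → Fin d → (Matrix n n ℂ)ˣ) (r : ℝ) (j : ℕ) (ν : Site d → Matrix n n ℂ) (x : Site d) :
    QprimeT L W j (fun y => r • ν y) x = r • QprimeT L W j ν x := by
  have h1 : (fun y => r • ν y) = fun y => ((r : ℂ) • ν y) := by funext y; rw [Complex.coe_smul]
  rw [h1, QprimeT_smulC, Complex.coe_smul]

/-- **THE TRANSPORTERS OF (1.29) ARE THOSE OF `Q′_k`**: `bgT L W j y x = transp L W j y x` (both `Ū₀ʲ(Γ_{Ly,x})`, definitional). [folklore] -/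
theorem bgT_eq_transp (L : ℕ) (W : Site d → Fin d → (Matrix n n ℂ)ˣ) (j : ℕ) (y x : Site d) :
    bgT L W j y x = transp L W j y x := by
  have hb : Literature.MathematicalPhysics.QuantumLattice.blockBase L y = (L : ℤ) • y := by
    funext i; simp [Literature.MathematicalPhysics.QuantumLattice.blockBase]
  unfold bgT transp axialFn
  rw [hb]

omit [DecidableEq n] in
/-- `hsR X (r • Y) = r · hsR X Y` (real `r`). [folklore] -/
theorem hsR_real_smul_right (X Y : Matrix n n ℂ) (r : ℝ) : hsR X (r • Y) = r * hsR X Y := by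
  unfold hsR UnitaryModel.nReTr
  rw [Matrix.mul_smul, Matrix.trace_smul, Complex.smul_re, smul_eq_mul, mul_div_assoc]

omit [DecidableEq n] in
/-- `hsR (r • X) Y = r · hsR X Y` (real `r`). [folklore] -/
theorem hsR_real_smul_left (X Y : Matrix n n ℂ) (r : ℝ) : hsR (r • X) Y = r * hsR X Y := by
  rw [NE3CovariantCalculus.hsR_comm, hsR_real_smul_right, NE3CovariantCalculus.hsR_comm]

/-- `cdiv` of periodic data is periodic. [folklore] -/
theorem cdiv_periodic {P : ℕ} {W : Site d → Fin d → (Matrix n n ℂ)ˣ} (hWP : IsPeriodicCfg W (P : ℤ)) {A : Site d → Fin d → Matrix n n ℂ}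
    (hA : IsPeriodicDir A (P : ℤ)) (x : Site d) (κ : Fin d) : cdiv W A (x + (P : ℤ) • e κ) = cdiv W A x := by
  unfold cdiv
  refine Finset.sum_congr rfl fun μ _ => ?_
  rw [hA x κ μ, show x + (P : ℤ) • e κ - e μ = (x - e μ) + (P : ℤ) • e κ by abel, hWP, hA]

/-! ## §2 Δ-symmetry on the torus -/

/-- **`Δ_W` IS SYMMETRIC FOR THE PERIODIC `hsR`-PAIRING**: `Σ_x hsR (F x) (Δ_W G x) = Σ_x hsR (Δ_W F x) (G x)` over a period box, for
unitary `P`-periodic `W` and `P`-periodic site fields `F, G` (both sides equal `Σ_ν Σ_x hsR (D_ν F x) (D_ν G x)` by the periodic summation by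
parts `NE3CovariantCalculus.sum_hsR_cD`). [folklore] -/
theorem sum_hsR_covLapSite_comm {P : ℕ} (hP : 1 ≤ P) {W : Site d → Fin d → (Matrix n n ℂ)ˣ} (hWu : IsUnitaryCfg W)
    (hWP : IsPeriodicCfg W (P : ℤ)) {F G : Site d → Matrix n n ℂ}
    (hF : ∀ (x : Site d) (κ : Fin d), F (x + (P : ℤ) • e κ) = F x) (hG : ∀ (x : Site d) (κ : Fin d), G (x + (P : ℤ) • e κ) = G x) :
    ∑ x ∈ periodBox (d := d) P, hsR (F x) (covLapSite W G x) = ∑ x ∈ periodBox (d := d) P, hsR (covLapSite W F x) (G x) := by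
  have key : ∀ {F G : Site d → Matrix n n ℂ}, (∀ (x : Site d) (κ : Fin d), F (x + (P : ℤ) • e κ) = F x) →
      (∀ (x : Site d) (κ : Fin d), G (x + (P : ℤ) • e κ) = G x) →
      ∑ x ∈ periodBox (d := d) P, hsR (F x) (covLapSite W G x) =
        ∑ ν : Fin d, ∑ x ∈ periodBox (d := d) P, hsR (cD W ν F x) (cD W ν G x) := by
    intro F G hF hG
    unfold covLapSite
    rw [Finset.sum_congr rfl fun x _ => hsR_sum_right _ (F x) _, Finset.sum_comm]
    refine Finset.sum_congr rfl fun ν _ => ?_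
    rw [sum_hsR_cD hP hWu hWP ν hF (cD_periodic hWP ν hG)]
  rw [key hF hG]
  have h2 : ∑ x ∈ periodBox (d := d) P, hsR (covLapSite W F x) (G x) = ∑ x ∈ periodBox (d := d) P, hsR (G x) (covLapSite W F x) :=
    Finset.sum_congr rfl fun x _ => NE3CovariantCalculus.hsR_comm _ _
  rw [h2, key hG hF]
  exact Finset.sum_congr rfl fun ν _ => Finset.sum_congr rfl fun x _ => NE3CovariantCalculus.hsR_comm _ _

/-! ## §3 The transpose of `Q′_k` on period boxes -/

/-- **THE BLOCKS OF `periodBox P` TILE `periodBox (L·P)`** (`L ≥ 1`). [folklore] -/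
theorem biUnion_blockSites_periodBox {L : ℕ} (hL : 1 ≤ L) (P : ℕ) :
    (periodBox (d := d) P).biUnion (blockSites L) = periodBox (d := d) (L * P) := by
  haveI : NeZero L := ⟨by omega⟩
  have hL0 : (0 : ℤ) < L := by exact_mod_cast hL
  ext x
  simp only [Finset.mem_biUnion, mem_blockSites_iff, mem_periodBox, exists_eq_right', blockMap]
  refine forall_congr' fun κ => ?_
  rw [Int.ediv_nonneg_iff_of_pos hL0, Int.ediv_lt_iff_lt_mul hL0, Nat.cast_mul, mul_comm (L : ℤ)]

/-- **ONE STEP OF THE TRANSPOSE** (unitary transporters): `Σ_{y∈periodBox P} hsR (ν y) ((Q′λ)(y)) = Σ_{x∈periodBox (L·P)} hsR ((Q′ᵀν)(x)) (λ x)`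
for the step `j` of `Q′_k(W)` (`Qprime` over `zdBlocking`, transporters `bgT L W j`) and its transpose stencil `qprimeT1 L W j` — `hsR`'s
`Ad`-invariance (`hsR_Ad_left`) block by block. [folklore] -/
theorem sum_hsR_qprime_step {L : ℕ} (hL : 1 ≤ L) (W : Site d → Fin d → (Matrix n n ℂ)ˣ) (j : ℕ)
    (hT : ∀ y x, bgT L W j y x ∈ unitaryUnits (Matrix n n ℂ)) (P : ℕ) (ν lam : Site d → Matrix n n ℂ) :
    ∑ y ∈ periodBox (d := d) P, hsR (ν y) (Qprime ((zdBlocking d L).B j y) ((zdBlocking d L).wt j y) (bgT L W j y) lam) =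
      ∑ x ∈ periodBox (d := d) (L * P), hsR (qprimeT1 L W j ν x) (lam x) := by
  haveI : NeZero L := ⟨by omega⟩
  have hdisj : ((periodBox (d := d) P : Finset (Site d)) : Set (Site d)).PairwiseDisjoint (blockSites L) := by
    intro y _ y' _ hne
    refine Finset.disjoint_left.mpr fun x hx hx' => hne ?_
    rw [mem_blockSites_iff] at hx hx'
    rw [← hx, ← hx']
  rw [← biUnion_blockSites_periodBox hL P, Finset.sum_biUnion hdisj]
  refine Finset.sum_congr rfl fun y _ => ?_
  show hsR (ν y) (∑ x ∈ blockSites L y, ((L : ℝ) ^ d)⁻¹ • conjR (bgT L W j y x) (lam x)) = _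
  rw [hsR_sum_right]
  refine Finset.sum_congr rfl fun x hx => ?_
  have hy : blockMap L x = y := (mem_blockSites_iff L y x).mp hx
  have h1 : hsR (ν y) (Ad (bgT L W j y x) (lam x)) = hsR (Ad (bgT L W j y x)⁻¹ (ν y)) (lam x) := by
    have := hsR_Ad_left ((unitaryUnits _).inv_mem (hT y x)) (ν y) (lam x)
    rw [inv_inv] at this
    exact this.symm
  rw [hsR_real_smul_right, conjR_eq_Ad, h1, qprimeT1, hy, conjR_eq_Ad, hsR_real_smul_left]

/-- **THE `j`-STEP TRANSPOSE**: `Σ_{y∈periodBox P} hsR (ν y) (Q′_jλ (y)) = Σ_{x∈periodBox (Lʲ·P)} hsR (Q′_jᵀν (x)) (λ x)` for unitary transporters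
at the steps `< j`. [folklore] -/
theorem sum_hsR_QprimeIter_eq {L : ℕ} (hL : 1 ≤ L) (W : Site d → Fin d → (Matrix n n ℂ)ˣ) :
    ∀ (j : ℕ), (∀ i, i < j → ∀ y x, bgT L W i y x ∈ unitaryUnits (Matrix n n ℂ)) → ∀ (P : ℕ) (ν lam : Site d → Matrix n n ℂ),
      ∑ y ∈ periodBox (d := d) P, hsR (ν y) (QprimeIter (zdBlocking d L) (bgT L W) j lam y) =
        ∑ x ∈ periodBox (d := d) (L ^ j * P), hsR (QprimeT L W j ν x) (lam x)
  | 0, _, P, ν, lam => by simp [QprimeT]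
  | j + 1, hT, P, ν, lam => by
    have hstep := sum_hsR_qprime_step hL W j (hT j (Nat.lt_succ_self j)) P ν (QprimeIter (zdBlocking d L) (bgT L W) j lam)
    have hih := sum_hsR_QprimeIter_eq hL W j (fun i hi => hT i (Nat.lt_succ_of_lt hi)) (L * P) (qprimeT1 L W j ν) lam
    simp only [QprimeIter_succ]
    rw [hstep, hih, show L ^ j * (L * P) = L ^ (j + 1) * P by ring]
    rfl

/-! ## §4 The dictionary: multiplier form (N05) ⟹ variational form (THE END), torus geometry -/

/-- On the all-torus constraint sets (`Λ_j = ∅` below `k`, `Λ_k = univ`) the multiplier stencil keeps the top level only: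
`QT L k Λ W μ x = Q′_kᵀ(μ k)(x)`. [folklore] -/
theorem QT_torus (L k : ℕ) (W : Site d → Fin d → (Matrix n n ℂ)ˣ) (μ : ℕ → Site d → Matrix n n ℂ) (x : Site d) :
    QT L k (fun j => if j = k then Set.univ else (∅ : Set (Site d))) W μ x = QprimeT L W k (μ k) x := by
  unfold QT
  rw [Finset.sum_eq_single_of_mem k (Finset.mem_range.2 (Nat.lt_succ_self k))]
  · simp
  · intro j _ hj
    simp only [hj, if_false, Set.indicator_empty]
    exact QprimeT_zero L W j x

/-- **THE (1.38) DICTIONARY, TORUS GEOMETRY**: node N05's concrete Landau condition in multiplier form, read with `Ω₀ = univ` and the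
all-torus constraint sets, IMPLIES THE END's `IsLandauB8` for the END-framed direction `Z = Ad_{W⁻¹}(iηA)` — for `L, N ≥ 1`, `η ≠ 0`, `W`
unitary `(N·Lᵏ)`-periodic whose averaged backgrounds `avgIter L W j`, `j < k`, are unitary (the transporters of `Q′_k`), and `A`
`(N·Lᵏ)`-periodic. [folklore] -/
theorem isLandauB8_of_isLandau138_torus [Nonempty n] {L N k : ℕ} (hL : 1 ≤ L) (hN : 1 ≤ N) {η : ℝ} (hη : η ≠ 0)
    {W : Site d → Fin d → (Matrix n n ℂ)ˣ} (hWu : IsUnitaryCfg W) (hWP : IsPeriodicCfg W ((N * L ^ k : ℕ) : ℤ))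
    (hWj : ∀ j, j < k → IsUnitaryCfg (avgIter L W j))
    {A : Site d → Fin d → Matrix n n ℂ} (hA : IsPeriodicDir A ((N * L ^ k : ℕ) : ℤ))
    (h138 : IsLandau138 L k η Set.univ (fun j => if j = k then Set.univ else (∅ : Set (Site d))) W A) :
    IsLandauB8 (d := d) L N k W (fun x μ => Ad (W x μ)⁻¹ (iEta η A x μ)) := by
  have hNL : 1 ≤ N * L ^ k := Nat.one_le_iff_ne_zero.mpr (Nat.mul_ne_zero (by omega) (pow_ne_zero _ (by omega)))
  have hY : IsPeriodicDir (iEta η A) ((N * L ^ k : ℕ) : ℤ) := fun x κ μ => by simp only [iEta, hA x κ μ]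
  have hT : ∀ i, i < k → ∀ y x, bgT L W i y x ∈ unitaryUnits (Matrix n n ℂ) := fun i hi y x => hol_mem_of (hWj i hi) _ _
  rw [isLandauB8_AdInv_iff_cdiv hNL hWu hWP hY]
  intro nu hnu
  obtain ⟨-, hper, hker⟩ := (mem_avgKernelGauges_iff (d := d) (n := n)).1 hnu
  obtain ⟨mult, hmult⟩ := h138
  -- the letters: `cdiv W (iηA) = c • D`, `D = covDivB η W A`, `c = −iη²`
  set D : Site d → Matrix n n ℂ := covDivB η W A with hD
  have hcdiv : ∀ x, cdiv W (iEta η A) x = (-(Complex.I * η * η) : ℂ) • D x := by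
    intro x
    have h1 : cdiv W (iEta η A) x = (Complex.I * η : ℂ) • cdiv W A x := by
      unfold iEta; exact cdiv_smulC W _ A x
    have h2 : cdiv W A x = -((η : ℝ) • D x) := by
      rw [hD, covDivB_eq, smul_neg, smul_smul, mul_inv_cancel₀ hη, one_smul, neg_neg]
    rw [h1, h2, smul_neg, ← Complex.coe_smul, smul_smul, ← neg_smul]
  -- `Δ_W D = η² • Q′_kᵀ (mult k)` pointwise, from the multiplier equation
  have hlap : ∀ x, covLapSite W D x = ((η * η : ℝ) : ℂ) • QprimeT L W k (mult k) x := by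
    intro x
    have h := hmult x (Set.mem_univ x)
    rw [Set.indicator_univ, QT_torus, covLap_eq] at h
    have h' : covLapSite W D x = (η * η) • QprimeT L W k (mult k) x := by
      rw [← h, smul_smul, smul_smul, show η * η * η⁻¹ * η⁻¹ = (η * η⁻¹) * (η * η⁻¹) by ring, mul_inv_cancel₀ hη, one_mul,
        one_smul]
    rw [h', Complex.coe_smul]
  -- periodicity of `F = cdiv W (iηA)`
  have hF : ∀ (x : Site d) (κ : Fin d), cdiv W (iEta η A) (x + ((N * L ^ k : ℕ) : ℤ) • e κ) = cdiv W (iEta η A) x :=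
    fun x κ => cdiv_periodic hWP hY x κ
  -- Δ-symmetry, then the multiplier equation, then the transpose, then the kernel
  rw [sum_hsR_covLapSite_comm hNL hWu hWP hF hper]
  have hlapF : ∀ x, covLapSite W (fun z => cdiv W (iEta η A) z) x =
      QprimeT L W k (fun y => (-(Complex.I * η * η) : ℂ) • (((η * η : ℝ) : ℂ) • mult k y)) x := by
    intro x
    have h1 : (fun z => cdiv W (iEta η A) z) = fun z => (-(Complex.I * η * η) : ℂ) • D z := funext hcdiv
    rw [h1, covLapSite_smulC, hlap, ← QprimeT_smulC, ← QprimeT_smulC]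
  rw [Finset.sum_congr rfl fun x _ => by rw [hlapF x], show N * L ^ k = L ^ k * N by ring,
    ← sum_hsR_QprimeIter_eq hL W k hT N _ nu]
  refine Finset.sum_eq_zero fun y _ => ?_
  have hk : QprimeIter (zdBlocking d L) (bgT L W) k nu y = 0 := by
    have hbt : bgT L W = transp L W := by
      funext j y x; exact bgT_eq_transp L W j y x
    rw [hbt]; exact hker y
  rw [hk]
  exact NE3LandauOrbit.hsR_zero_right _

end

end Summit.QuantumFields.BalabanUV.T4Continuum.NE3.PairLandau138B8
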